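import Summits.CriticalPhenomena.PercolationContinuityZ3.Theorems.Transplant.Z3ChiralDozen
import HarnessLib

/-!
# `Cay(ℤ³; S)` with a RIGID ROOTED LINK: from the local dichotomy "an automorphism fixing `0` is `id` or `−1` on `S`" to `Aut = ℤ³ ⋊ {±1}`,
# and hence NO `PlanarSkeletonSign` / `PlanarSkeletonConc` for any skeleton map — GENERIC in the unit-range family (the globalisation and the
# no-go of `Z3ChiralDozen`, p259219, with the member as a parameter; P5-SHARPNESS row 39 / CHIRAL-UNITGENS.md; V111 (1): "certificates wanted for
# the 264 chiral unit-range `S`")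

builds on p205010 (kernel theorem, internal audit signed; external expert review pending) — nothing in this file uses p205010.
Lane `prim-bschramm`, seat `prim-bschramm-p5` (gen 7; refuter), helper file (`--supports stmt-CriticalPhenomena-4575`).  NEW FILE; no statement item.

THE POINT.  `Z3ChiralDozen` proved `Aut X⋆ = ℤ³ ⋊ {±1}` for ONE chiral generating set in two halves: a member-specific CHASE (eleven `decide` facts:
an automorphism fixing `0` and the link-isolated generator `q` fixes the whole link) and a member-independent GLOBALISATION (walk induction) +
NO-GO (`neg` and `flip` at a base vertex are each `id` or the inversion, which the (ι)-steps forbid).  This file states the interface between the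
two halves — **`UnitGens.LinkDichotomy U`**: every automorphism of `Cay(ℤ³; U.S)` fixing `0` is the identity or the central inversion ON THE LINK
`U.S` — and proves the second half ONCE for the whole family:
* `UnitGens.aut_cases_of_linkDichotomy` — **`LinkDichotomy U → Aut = ℤ³ ⋊ {±1}`** (every automorphism is `w ↦ c + w` or `w ↦ c − w`),
  `stabilizer_cases_of_linkDichotomy`;
* **`UnitGens.isEmpty_planarSkeletonSign_of_linkDichotomy`**, **`isEmpty_planarSkeletonConc_of_linkDichotomy`** — for every skeleton map;
* `Z3Chiral.linkDichotomy : Z3Chiral.Ustar.LinkDichotomy` (the landed chase, repackaged) — the interface is inhabited.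
So certifying any further member of the 264 chiral sets (CHIRAL-UNITGENS.md; 72 of them have a rooted link rigid under (adjacency, common-neighbour
counts)) costs only its chase; the class-map consequence (tier "{±1} only": the D″ and Conc nodes cannot be instantiated by ANY `φ`, the `{±1}`
node can) follows by these three theorems.
[cite: BenjaminiSchramm1996, Conj. 4 and §2] [cite: KozmaNitzan2024, §4 p. 16 (Lemma 8)] [cite: LeemannDelasalle2022, Cor. 1.2 (p. 3)]
-/

noncomputable section

namespace Summit.CriticalPhenomena.PercolationContinuityZ3.Theorems.Transplant

open MeasureTheory Literature.Probability.Percolation Literature.Probability.LatticeModels SimpleGraph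

namespace UnitGens

variable (U : UnitGens)

/-- **The rooted-link dichotomy** of a member: every automorphism fixing `0` is, on the twelve-or-so neighbours `U.S` of `0`, the identity or
the central inversion. (For `S⋆` this is `Z3Chiral.aut_zero_cases`; it FAILS for every member with a linear symmetry `≠ ±I`, e.g. the 268
flip-certified ones.) [this work] -/
def LinkDichotomy : Prop :=
  ∀ α : U.graph ≃g U.graph, α 0 = 0 → (∀ s ∈ U.S, α s = s) ∨ (∀ s ∈ U.S, α s = -s)

variable {U}

/-! ## §1 Globalisation -/

/-- Conjugating by the translation to `u`: an automorphism fixing `u` fixes `N(u)` pointwise or inverts it through `u`. [this work] -/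
theorem aut_fix_cases_local (h : U.LinkDichotomy) (α : U.graph ≃g U.graph) {u : Site 3} (hu : α u = u) :
    (∀ s ∈ U.S, α (u + s) = u + s) ∨ (∀ s ∈ U.S, α (u + s) = u - s) := by
  let β : U.graph ≃g U.graph := (U.shift u).trans (α.trans (U.shift (-u)))
  have hβ : ∀ w, β w = -u + α (u + w) := fun w => rfl
  have hβ0 : β 0 = 0 := by rw [hβ, add_zero, hu, neg_add_cancel]
  rcases h β hβ0 with h | h
  · left; intro s hs
    have := h s hs; rw [hβ] at this
    rw [← add_right_inj (-u), ← add_assoc, neg_add_cancel, zero_add]; exact this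
  · right; intro s hs
    have := h s hs; rw [hβ] at this
    rw [sub_eq_add_neg, ← add_right_inj (-u), ← add_assoc, neg_add_cancel, zero_add]; exact this

/-- **Propagation step**: an automorphism fixing two ADJACENT vertices `v ∼ u` fixes `N(u)` pointwise. [this work] -/
theorem aut_fix_link_of_fix_two (h : U.LinkDichotomy) (α : U.graph ≃g U.graph) {v u : Site 3} (hv : α v = v) (hu : α u = u)
    (hadj : U.graph.Adj u v) : ∀ s ∈ U.S, α (u + s) = u + s := by
  rcases aut_fix_cases_local h α hu with h' | h'
  · exact h'
  · exfalso
    have hs : v - u ∈ U.S := (U.graph_adj_iff _ _).1 hadj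
    have h1 := h' _ hs
    rw [add_sub_cancel, hv] at h1
    have : v = u := by
      funext i
      have h2 := congrFun h1 i
      simp only [Pi.sub_apply] at h2
      omega
    exact hadj.ne this.symm

/-- **An automorphism fixing `0` and its link is the identity** (walk induction from `0`; the Cayley graph is connected). [this work] -/
theorem aut_eq_of_fix_link (h : U.LinkDichotomy) (α : U.graph ≃g U.graph) (h0 : α 0 = 0) (h1 : ∀ s ∈ U.S, α s = s) (w : Site 3) :
    α w = w := by
  suffices H : ∀ x y : Site 3, U.graph.Reachable x y → (α x = x ∧ ∀ s ∈ U.S, α (x + s) = x + s) → α y = y ∧ ∀ s ∈ U.S, α (y + s) = y + s by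
    exact (H 0 w (U.graph_connected.preconnected 0 w) ⟨h0, fun s hs => by rw [zero_add]; exact h1 s hs⟩).1
  intro x y hxy
  obtain ⟨p⟩ := hxy
  induction p with
  | nil => exact id
  | @cons a b c hab _ ih =>
      intro ha
      apply ih
      have hs : b - a ∈ U.S := (U.graph_adj_iff _ _).1 hab
      have hb : α b = b := by have := ha.2 _ hs; rwa [add_sub_cancel] at this
      exact ⟨hb, aut_fix_link_of_fix_two h α ha.1 hb hab.symm⟩

/-- **`LinkDichotomy ⇒ Aut Cay(ℤ³; S) = ℤ³ ⋊ {±1}`**: every automorphism is `w ↦ c + w` or `w ↦ c − w` (the least an abelian group of exponent `> 2`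
allows — no GRR). [cite: LeemannDelasalle2022, Cor. 1.2 (p. 3)] -/
theorem aut_cases_of_linkDichotomy (h : U.LinkDichotomy) (α : U.graph ≃g U.graph) :
    (∀ w, α w = α 0 + w) ∨ (∀ w, α w = α 0 - w) := by
  let β : U.graph ≃g U.graph := α.trans (U.shift (-α 0))
  have hβ : ∀ w, β w = -α 0 + α w := fun w => rfl
  have hβ0 : β 0 = 0 := by rw [hβ, neg_add_cancel]
  rcases h β hβ0 with h' | h'
  · left; intro w
    have := aut_eq_of_fix_link h β hβ0 h' w
    rw [hβ] at this
    exact neg_add_eq_iff_eq_add.1 this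
  · right; intro w
    let β' : U.graph ≃g U.graph := β.trans U.negIso
    have hβ' : ∀ x, β' x = -β x := fun x => rfl
    have hβ'0 : β' 0 = 0 := by rw [hβ', hβ0, neg_zero]
    have h'' : ∀ s ∈ U.S, β' s = s := fun s hs => by rw [hβ', h' s hs, neg_neg]
    have := aut_eq_of_fix_link h β' hβ'0 h'' w
    rw [hβ', hβ, neg_add, neg_neg, ← sub_eq_add_neg] at this
    have h3 : α w + w = α 0 := by rw [add_comm]; exact (sub_eq_iff_eq_add.1 this).symm
    exact eq_sub_of_add_eq h3

/-- **Vertex stabilisers are `{id, inversion through the vertex}`.** [this work] -/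
theorem stabilizer_cases_of_linkDichotomy (h : U.LinkDichotomy) (α : U.graph ≃g U.graph) {t : Site 3} (ht : α t = t) :
    (∀ w, α w = w) ∨ (∀ w, α w = (2 : ℤ) • t - w) := by
  rcases aut_cases_of_linkDichotomy h α with h' | h'
  · left; intro w
    have h0 : α 0 = 0 := by have := h' t; rw [ht] at this; simpa using (this.symm : α 0 + t = t)
    rw [h' w, h0, zero_add]
  · right; intro w
    have h0 : α 0 = (2 : ℤ) • t := by have := h' t; rw [ht] at this; rw [two_smul]; exact (sub_eq_iff_eq_add.1 this.symm)
    rw [h' w, h0]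

/-! ## §2 No `PlanarSkeletonSign`, no `PlanarSkeletonConc` — for any skeleton map -/

/-- **The sign obstruction at a vertex** (generic form of `Z3Chiral.no_neg_and_flip`). [this work] -/
theorem no_neg_and_flip_of_linkDichotomy (h : U.LinkDichotomy) (φ : Site 3 → Site 2) (t : Site 3) (ρ ρ₁ : U.graph ≃g U.graph)
    (hρt : ρ t = t) (hρ : ∀ w, φ (ρ w) - φ t = -(φ w - φ t)) (hρ₁t : ρ₁ t = t) (hρ₁ : ∀ w, φ (ρ₁ w) - φ t = flipSnd (φ w - φ t))
    {w₀ : Site 3} (h₀ : φ w₀ = φ t + Pi.single 0 1) {w₁ : Site 3} (h₁ : φ w₁ = φ t + Pi.single 1 1) : False := by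
  have e₀ : φ w₀ - φ t = Pi.single 0 1 := by rw [h₀, add_sub_cancel_left]
  have e₁ : φ w₁ - φ t = Pi.single 1 1 := by rw [h₁, add_sub_cancel_left]
  rcases stabilizer_cases_of_linkDichotomy h ρ hρt with hid | hinv
  · have h' := hρ w₀
    rw [hid w₀, e₀] at h'
    have := congrFun h' 0
    simp at this
  rcases stabilizer_cases_of_linkDichotomy h ρ₁ hρ₁t with hid₁ | hinv₁
  · have h' := hρ₁ w₁
    rw [hid₁ w₁, e₁] at h'
    have := congrFun h' 1
    simp at this
  · have h' := hρ₁ w₀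
    rw [hinv₁ w₀, ← hinv w₀, hρ w₀, e₀] at h'
    have := congrFun h' 0
    simp at this

/-- **`LinkDichotomy ⇒` no `PlanarSkeletonSign` on `Cay(ℤ³; S)`, for any skeleton map.** [cite: KozmaNitzan2024, §4 p. 16 (Lemma 8)] -/
theorem isEmpty_planarSkeletonSign_of_linkDichotomy (h : U.LinkDichotomy) : IsEmpty (PlanarSkeletonSign U.graph) := by
  refine ⟨fun Φ => ?_⟩
  obtain ⟨t, ht, -⟩ := Φ.frame 0
  obtain ⟨ρ, hρt, hρ⟩ := Φ.neg t ht
  obtain ⟨ρ₁, hρ₁t, hρ₁⟩ := Φ.flip t ht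
  obtain ⟨w₀, -, h₀⟩ := Φ.step t 0 1
  obtain ⟨w₁, -, h₁⟩ := Φ.step t 1 1
  exact no_neg_and_flip_of_linkDichotomy h Φ.φ t ρ ρ₁ hρt hρ hρ₁t hρ₁ (by simpa using h₀) (by simpa using h₁)

/-- **`LinkDichotomy ⇒` no `PlanarSkeletonConc` on `Cay(ℤ³; S)`** (the node of record cannot be instantiated, by any `φ`). [cite: KozmaNitzan2024, §4 p. 16 (Lemma 8)] -/
theorem isEmpty_planarSkeletonConc_of_linkDichotomy (h : U.LinkDichotomy) : IsEmpty (PlanarSkeletonConc U.graph) := by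
  refine ⟨fun Φ => ?_⟩
  obtain ⟨t, ht, -⟩ := Φ.frame 0
  obtain ⟨ρ, hρt, hρ⟩ := Φ.point t ht Skel.negElt
  obtain ⟨ρ₁, hρ₁t, hρ₁⟩ := Φ.point t ht Skel.flipElt
  obtain ⟨w₀, -, h₀⟩ := Φ.step t 0 1
  obtain ⟨w₁, -, h₁⟩ := Φ.step t 1 1
  refine no_neg_and_flip_of_linkDichotomy h Φ.φ t ρ ρ₁ hρt (fun w => ?_) hρ₁t (fun w => ?_) (by simpa using h₀) (by simpa using h₁)
  · rw [hρ w]; funext i; rw [Skel.sp_negElt_apply]; rfl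
  · rw [hρ₁ w]
    obtain ⟨h0', h1'⟩ := Skel.sp_flipElt_apply (Φ.φ w - Φ.φ t)
    funext i
    fin_cases i
    · simpa using h0'
    · simpa using h1'

/-- Conversely, a member WITH a linear symmetry other than `±I` fixing the axes' sign pattern — e.g. a flip certificate in the identity
frame — violates the dichotomy: the central inversion is the ONLY non-trivial symmetry the dichotomy allows at `0`. Recorded in the simplest
case: an additive involution `f` preserving `S` with `f (e₀) = e₀` and `f (e₁) = −e₁` is an automorphism fixing `0` that is neither branch.
[this work] -/
theorem not_linkDichotomy_of_axisFlip (f : Site 3 →+ Site 3) (hf : Function.Involutive f) (hS : ∀ s ∈ U.S, f s ∈ U.S)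
    (h0 : f (Z3Diag.ev 0) = Z3Diag.ev 0) (h1 : f (Z3Diag.ev 1) = -Z3Diag.ev 1) : ¬ U.LinkDichotomy := by
  intro h
  have hα0 : U.isoOfLinear f hf hS 0 = 0 := by rw [UnitGens.isoOfLinear_apply, map_zero]
  rcases h (U.isoOfLinear f hf hS) hα0 with h' | h'
  · have := h' _ (U.axes 1)
    rw [UnitGens.isoOfLinear_apply, h1] at this
    have := congrFun this 1
    simp [Z3Diag.ev] at this
  · have := h' _ (U.axes 0)
    rw [UnitGens.isoOfLinear_apply, h0] at this
    have := congrFun this 0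
    simp [Z3Diag.ev] at this

end UnitGens

/-! ## §3 The interface is inhabited: the chiral dozen -/

namespace Z3Chiral

/-- **`S⋆` satisfies the rooted-link dichotomy** (the chase of `Z3ChiralDozen`, repackaged). [this work] -/
theorem linkDichotomy : Ustar.LinkDichotomy := fun α h0 => aut_zero_cases α h0

/-- Sanity: the generic no-go re-proves the landed one. [folklore] -/
example : IsEmpty (PlanarSkeletonSign X) := UnitGens.isEmpty_planarSkeletonSign_of_linkDichotomy linkDichotomy

end Z3Chiral

end Summit.CriticalPhenomena.PercolationContinuityZ3.Theorems.Transplant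

end
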